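import Mathlib.Analysis.InnerProductSpace.PiL2
import Mathlib.Analysis.Normed.Module.FiniteDimension
import Mathlib.Topology.MetricSpace.Sequences
import HarnessLib

/-!
# Route CalmSliceGate, crux `OneSymmetricSlice` (stmt-NavierStokesRegularity-24452), stub
# `stub_symmetricLimit` — helper I: sequential compactness of the isometry group of `ℝ³`

Every sequence `g_j` of linear isometry equivalences of `ℝ³ = EuclideanSpace ℝ (Fin 3)` has a
subsequence converging pointwise, together with the inverses, to a linear isometry equivalence
(`exists_subseq_tendsto_linearIsometryEquiv`): the unit ball of the finite-dimensional space of
continuous linear maps is compact, norm preservation is a closed condition, and a linear isometry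
of a finite-dimensional space onto itself is an equivalence.  Also the bookkeeping lemma
`tendsto_apply_of_tendsto` (moving isometries applied to moving vectors).

Elementary functional analysis; nothing here is specific to the Navier–Stokes equations.
-/

set_option linter.dupNamespace false

noncomputable section

open Filter Topology Metric

namespace Summit.NavierStokesRegularity.NavierStokesRegularity.Theorems.OneSymmetricSlice

/-- **Moving isometries applied to moving vectors.** If the linear isometry equivalences `g j`
converge pointwise to `gL` and `a j → aL`, then `g j (a j) → gL aL`
(`‖g_j a_j − gL aL‖ ≤ ‖a_j − aL‖ + ‖g_j aL − gL aL‖`). [folklore] -/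
theorem tendsto_apply_of_tendsto
    {g : ℕ → EuclideanSpace ℝ (Fin 3) ≃ₗᵢ[ℝ] EuclideanSpace ℝ (Fin 3)}
    {gL : EuclideanSpace ℝ (Fin 3) ≃ₗᵢ[ℝ] EuclideanSpace ℝ (Fin 3)}
    (hg : ∀ z, Tendsto (fun j => g j z) atTop (𝓝 (gL z)))
    {a : ℕ → EuclideanSpace ℝ (Fin 3)} {aL : EuclideanSpace ℝ (Fin 3)}
    (ha : Tendsto a atTop (𝓝 aL)) :
    Tendsto (fun j => g j (a j)) atTop (𝓝 (gL aL)) := by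
  rw [tendsto_iff_norm_sub_tendsto_zero]
  have h1 : Tendsto (fun j => ‖a j - aL‖) atTop (𝓝 0) :=
    tendsto_iff_norm_sub_tendsto_zero.1 ha
  have h2 : Tendsto (fun j => ‖g j aL - gL aL‖) atTop (𝓝 0) :=
    tendsto_iff_norm_sub_tendsto_zero.1 (hg aL)
  have h12 : Tendsto (fun j => ‖a j - aL‖ + ‖g j aL - gL aL‖) atTop (𝓝 0) := by
    simpa using h1.add h2
  refine squeeze_zero (fun j => norm_nonneg _) (fun j => ?_) h12
  calc ‖g j (a j) - gL aL‖ ≤ ‖g j (a j) - g j aL‖ + ‖g j aL - gL aL‖ := norm_sub_le_norm_sub_add_norm_sub _ _ _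
    _ = ‖a j - aL‖ + ‖g j aL - gL aL‖ := by rw [← map_sub, LinearIsometryEquiv.norm_map]

/-- **Sequential compactness of the isometry group of `ℝ³`.** Every sequence of linear isometry
equivalences of `ℝ³` has a subsequence converging pointwise, together with the inverses, to a
linear isometry equivalence. [folklore] -/
theorem exists_subseq_tendsto_linearIsometryEquiv
    (g : ℕ → EuclideanSpace ℝ (Fin 3) ≃ₗᵢ[ℝ] EuclideanSpace ℝ (Fin 3)) :
    ∃ φ : ℕ → ℕ, StrictMono φ ∧
      ∃ gL : EuclideanSpace ℝ (Fin 3) ≃ₗᵢ[ℝ] EuclideanSpace ℝ (Fin 3),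
        (∀ z, Tendsto (fun j => g (φ j) z) atTop (𝓝 (gL z))) ∧
        (∀ z, Tendsto (fun j => (g (φ j)).symm z) atTop (𝓝 (gL.symm z))) := by
  -- the isometries as points of the unit ball of `E →L[ℝ] E`, a proper space
  set T : ℕ → (EuclideanSpace ℝ (Fin 3) →L[ℝ] EuclideanSpace ℝ (Fin 3)) :=
    fun j => (g j).toLinearIsometry.toContinuousLinearMap with hT
  haveI : ProperSpace (EuclideanSpace ℝ (Fin 3) →L[ℝ] EuclideanSpace ℝ (Fin 3)) :=
    FiniteDimensional.proper ℝ _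
  have hTmem : ∀ j, T j ∈ closedBall (0 : EuclideanSpace ℝ (Fin 3) →L[ℝ] EuclideanSpace ℝ (Fin 3)) 1 := by
    intro j
    rw [mem_closedBall, dist_zero_right]
    exact (g j).toLinearIsometry.norm_toContinuousLinearMap_le
  obtain ⟨TL, -, φ, hφ, hlim⟩ := tendsto_subseq_of_bounded isBounded_closedBall hTmem
  -- pointwise convergence and norm preservation of the limit
  have hpt : ∀ z, Tendsto (fun j => g (φ j) z) atTop (𝓝 (TL z)) := by
    intro z
    have h := ((ContinuousLinearMap.apply ℝ (EuclideanSpace ℝ (Fin 3)) z).continuous.tendsto TL).comp hlim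
    simpa [hT, Function.comp_def] using h
  have hnorm : ∀ z, ‖TL z‖ = ‖z‖ := by
    intro z
    have h1 : Tendsto (fun j => ‖g (φ j) z‖) atTop (𝓝 ‖TL z‖) := (hpt z).norm
    have h2 : Tendsto (fun j => ‖g (φ j) z‖) atTop (𝓝 ‖z‖) := by
      simp only [LinearIsometryEquiv.norm_map]
      exact tendsto_const_nhds
    exact tendsto_nhds_unique h1 h2
  -- the limit is a linear isometry equivalence
  set L : EuclideanSpace ℝ (Fin 3) →ₗᵢ[ℝ] EuclideanSpace ℝ (Fin 3) :=
    ⟨TL.toLinearMap, hnorm⟩ with hL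
  set gL : EuclideanSpace ℝ (Fin 3) ≃ₗᵢ[ℝ] EuclideanSpace ℝ (Fin 3) :=
    L.toLinearIsometryEquiv rfl with hgL
  have hgL_apply : ∀ z, gL z = TL z := fun z => rfl
  have hptg : ∀ z, Tendsto (fun j => g (φ j) z) atTop (𝓝 (gL z)) := fun z => by
    rw [hgL_apply]; exact hpt z
  refine ⟨φ, hφ, gL, hptg, fun z => ?_⟩
  -- convergence of the inverses: `‖g_j⁻¹ z − gL⁻¹ z‖ = ‖z − g_j (gL⁻¹ z)‖ → ‖z − z‖ = 0`
  rw [tendsto_iff_norm_sub_tendsto_zero]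
  have e : ∀ j, ‖(g (φ j)).symm z - gL.symm z‖ = ‖z - g (φ j) (gL.symm z)‖ := by
    intro j
    rw [← (g (φ j)).norm_map ((g (φ j)).symm z - gL.symm z), map_sub,
      LinearIsometryEquiv.apply_symm_apply]
  simp only [e]
  have h := hptg (gL.symm z)
  rw [LinearIsometryEquiv.apply_symm_apply] at h
  have h2 : Tendsto (fun j => z - g (φ j) (gL.symm z)) atTop (𝓝 (z - z)) := tendsto_const_nhds.sub h
  rw [sub_self] at h2
  simpa using h2.norm

end Summit.NavierStokesRegularity.NavierStokesRegularity.Theorems.OneSymmetricSlice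

end
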